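import Literature.NumberTheory.IwasawaTheory.PruferPontryaginDual
import Mathlib.GroupTheory.FiniteAbelian.Basic
import Mathlib.GroupTheory.PGroup
import Mathlib.RingTheory.RootsOfUnity.PrimitiveRoots
import HarnessLib

/-!
# Characters into the Prüfer module `ℚ_p/ℤ_p` SEPARATE THE POINTS of finite abelian `p`-groups
# (`t_k = [p^{-k}]` is a primitive `p^k`-th root of unity of `Multiplicative (ℚ_p/ℤ_p)`)

Topic `NumberTheory/IwasawaTheory`; namespace `Literature.NumberTheory.IwasawaTheory.QpModZp` (the story of
`PruferPontryaginDual.lean`: `QpModZp p = ℚ_[p] ⧸ ℤ_[p]`, generators `tgen p k`). Cell `bsd-print-cf2`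
(`run/shared/lean/pub/bsd-print-cf2/`), seat `bsd-line-cf2c-w3` g7 (prover, width). WHY: the class-field-theoretic
half `ker υ ⊆ Ē` of the four-term sequence (cell file `Theorems/PrintCf2RubinValueTwoFourTermCFTPairingSelmer.lean`,
`rep_mem_unitsClosure_of_forall_pairing_eq_zero`) carries the displayed hypothesis
`hsep : ∀ (G : Type) [Group G] [Finite G] [IsMulCommutative G], IsPGroup p G → ∀ g : G, g ≠ 1 →
∃ χ : G →* Multiplicative M, χ g ≠ 1` — "characters into `M` separate the points of finite abelian
`p`-groups" — noted there as "true for `M ≅ ℚ_p/ℤ_p`" (memo `BRICK-D-FOURTERM-PAIRING-w6g5.md` §3 item 2).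
This file proves it for `M = ℚ_p/ℤ_p` and for every abelian group `M` receiving an injective additive map
from `ℚ_p/ℤ_p` (e.g. Keller–Yin's character module `(F/𝓞)(θ) ≃ ℚ_p/ℤ_p`, `KellerYin2024.charModuleEquiv`):
Pontryagin duality for finite abelian groups (Neukirch–Schmidt–Wingberg (1.1.8): characters separate
points) needs only, for each cyclic factor `ℤ/p^k`, an element of order exactly `p^k` in the target, and
`t_k = [p^{-k}] ∈ ℚ_p/ℤ_p` is one (Hungerford I §3 Ex. 7: `⟨1/p^k⟩ ≅ Z_{p^k}`). THEOREMS ONLY (no `def`,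
no named fact, no `sorry`, no `instance`).

## Contents
* `QpModZp.nsmul_tgen_eq_zero_iff` — `l • t_k = 0 ↔ p^k ∣ l`; `QpModZp.isPrimitiveRoot_ofAdd_tgen` —
  `ofAdd t_k` is a primitive `p^k`-th root of unity of `Multiplicative (ℚ_p/ℤ_p)`.
* **`QpModZp.exists_monoidHom_apply_ne_one`** — for a finite commutative `p`-group `G` and `g ≠ 1` there is
  `χ : G →* Multiplicative (ℚ_p/ℤ_p)` with `χ g ≠ 1` (Mathlib's structure theorem
  `CommGroup.equiv_prod_multiplicative_zmod_of_finite` + `ZMod.exists_monoidHom_apply_ne_one`).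
* **`QpModZp.exists_monoidHom_apply_ne_one_of_injective`** (any `M` with `j : ℚ_p/ℤ_p ↪ M`) and
  **`QpModZp.separatesPoints_of_injective`** = the hypothesis `hsep` VERBATIM (`G : Type`).

HONEST FRAMING: finite-group infrastructure; nothing about elliptic curves; BSD is not advanced by this file.

## References
* [NeukirchSchmidtWingberg2008] J. Neukirch, A. Schmidt, K. Wingberg, *Cohomology of Number Fields*, 2nd ed.,
  I §1 (1.1.8) (Pontryagin duality; characters separate points).
* [Hungerford1974] T. W. Hungerford, *Algebra*, GTM 73, Ch. I §3 Exercise 7 (b)/(d) (`Z(p^∞)`: the elements of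
  order `≤ p^k` form `⟨1/p^k⟩ ≅ Z_{p^k}`), Ch. II §2 (structure of finite abelian groups).
* Mathlib: `CommGroup.equiv_prod_multiplicative_zmod_of_finite`, `ZMod.exists_monoidHom_apply_ne_one`,
  `IsPGroup.iff_orderOf`.
-/

noncomputable section

namespace Literature.NumberTheory.IwasawaTheory.QpModZp

variable (p : ℕ) [Fact p.Prime]

/-- **`t_k` has additive order exactly `p^k`**: `l • t_k = 0 ↔ p^k ∣ l`.
[cite: Hungerford1974, Ch. I §3 Exercise 7 (b) (PDF p. 88: bounded orders `≤ p^k` ⇒ `⟨1/p^k⟩ ≅ Z_{p^k}`)] -/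
theorem nsmul_tgen_eq_zero_iff (k l : ℕ) : l • tgen p k = 0 ↔ p ^ k ∣ l := by
  constructor
  · intro h
    have h' : (l : ℤ_[p]) • tgen p k = ((0 : ℕ) : ℤ_[p]) • tgen p k := by
      rw [Nat.cast_smul_eq_nsmul, h, Nat.cast_zero, zero_smul]
    have h0 := natCast_eq_natCast_of_smul_tgen_eq (p := p) h'
    rw [Nat.cast_zero, ZMod.natCast_eq_zero_iff] at h0
    exact h0
  · rintro ⟨m, rfl⟩
    rw [mul_comm, ← smul_smul, pow_nsmul_tgen, nsmul_zero]

/-- **`ofAdd t_k` is a PRIMITIVE `p^k`-th root of unity of `Multiplicative (ℚ_p/ℤ_p)`** (an element of order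
exactly `p^k`). [cite: Hungerford1974, Ch. I §3 Exercise 7 (b)/(d) (PDF p. 88)] -/
theorem isPrimitiveRoot_ofAdd_tgen (k : ℕ) :
    IsPrimitiveRoot (Multiplicative.ofAdd (tgen p k)) (p ^ k) := by
  rw [IsPrimitiveRoot.iff_def]
  refine ⟨?_, fun l hl ↦ ?_⟩
  · rw [← ofAdd_nsmul, pow_nsmul_tgen, ofAdd_zero]
  · rw [← ofAdd_nsmul, ofAdd_eq_one] at hl
    exact (nsmul_tgen_eq_zero_iff p k l).mp hl

/-- **Characters into `ℚ_p/ℤ_p` separate the points of finite abelian `p`-groups**: for `G` a finite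
commutative `p`-group and `g ≠ 1` there is `χ : G →* Multiplicative (ℚ_p/ℤ_p)` with `χ g ≠ 1` — decompose
`G ≅ ∏ ℤ/n_i` (each `n_i` the order of an element, so a power of `p`), pick a factor where `g` is visible, and
map `ℤ/p^k` onto `⟨t_k⟩`. [cite: NeukirchSchmidtWingberg2008, I §1 (1.1.8)] [cite: Hungerford1974, Ch. II §2 Thm. 2.6] -/
theorem exists_monoidHom_apply_ne_one (G : Type*) [Group G] [Finite G] [IsMulCommutative G]
    (hG : IsPGroup p G) {g : G} (hg : g ≠ 1) :
    ∃ χ : G →* Multiplicative (QpModZp p), χ g ≠ 1 := by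
  classical
  letI : CommGroup G := { ‹Group G› with mul_comm := mul_comm' }
  obtain ⟨ι, _, n, hn, ⟨e⟩⟩ := CommGroup.equiv_prod_multiplicative_zmod_of_finite G
  obtain ⟨i, hi⟩ : ∃ i : ι, e g i ≠ 1 := by
    by_contra h
    exact hg ((MulEquiv.map_eq_one_iff e).mp (funext fun i ↦ not_ne_iff.mp (not_exists.mp h i)))
  -- `n i` is the order of an element of the `p`-group `G`, hence a power of `p`
  obtain ⟨k, hk⟩ : ∃ k : ℕ, n i = p ^ k := by
    obtain ⟨k, hk⟩ := (IsPGroup.iff_orderOf.mp hG) (e.symm (Pi.mulSingle i (Multiplicative.ofAdd 1)))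
    refine ⟨k, ?_⟩
    rw [← hk, MulEquiv.orderOf_eq, orderOf_piMulSingle, orderOf_ofAdd_eq_addOrderOf, ZMod.addOrderOf_one]
  haveI : NeZero (n i) := ⟨fun h0 ↦ by have := hn i; omega⟩
  have hprim : ∃ ζ : Multiplicative (QpModZp p), IsPrimitiveRoot ζ (n i) :=
    ⟨Multiplicative.ofAdd (tgen p k), by rw [hk]; exact isPrimitiveRoot_ofAdd_tgen p k⟩
  have ha : Multiplicative.toAdd (e g i) ≠ 0 := fun h0 ↦ hi (toAdd_eq_zero.mp h0)
  obtain ⟨φ, hφ⟩ := ZMod.exists_monoidHom_apply_ne_one hprim ha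
  rw [ofAdd_toAdd] at hφ
  refine ⟨(Units.coeHom _).comp (φ.comp ((Pi.evalMonoidHom (fun j ↦ Multiplicative (ZMod (n j))) i).comp
    e.toMonoidHom)), fun h1 ↦ hφ ?_⟩
  simpa using h1

/-- **Characters into any `M ⊇ ℚ_p/ℤ_p` separate the points of finite abelian `p`-groups**: if `j : ℚ_p/ℤ_p → M`
is an injective additive map then for `G` a finite commutative `p`-group and `g ≠ 1` there is
`χ : G →* Multiplicative M` with `χ g ≠ 1` (e.g. `M = (F/𝓞)(θ) ≃ ℚ_p/ℤ_p`).
[cite: NeukirchSchmidtWingberg2008, I §1 (1.1.8)] -/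
theorem exists_monoidHom_apply_ne_one_of_injective {M : Type*} [AddCommGroup M] (j : QpModZp p →+ M)
    (hj : Function.Injective j) (G : Type*) [Group G] [Finite G] [IsMulCommutative G]
    (hG : IsPGroup p G) {g : G} (hg : g ≠ 1) :
    ∃ χ : G →* Multiplicative M, χ g ≠ 1 := by
  obtain ⟨χ, hχ⟩ := exists_monoidHom_apply_ne_one p G hG hg
  refine ⟨(AddMonoidHom.toMultiplicative j).comp χ, fun h ↦ hχ ?_⟩
  rw [MonoidHom.comp_apply, AddMonoidHom.toMultiplicative_apply_apply, ofAdd_eq_one] at h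
  exact toAdd_eq_zero.mp (hj (h.trans (map_zero j).symm))

/-- **The hypothesis `hsep` of the cell's `rep_mem_unitsClosure_of_forall_pairing_eq_zero`, VERBATIM, for
every `M` receiving an injective additive map from `ℚ_p/ℤ_p`**: characters into `M` separate the points of
finite abelian `p`-groups. [cite: NeukirchSchmidtWingberg2008, I §1 (1.1.8)] -/
theorem separatesPoints_of_injective {M : Type*} [AddCommGroup M] (j : QpModZp p →+ M)
    (hj : Function.Injective j) :
    ∀ (G : Type) [Group G] [Finite G] [IsMulCommutative G], IsPGroup p G →
      ∀ g : G, g ≠ 1 → ∃ χ : G →* Multiplicative M, χ g ≠ 1 :=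
  fun G _ _ _ hG _ hg ↦ exists_monoidHom_apply_ne_one_of_injective p j hj G hG hg

/-- The case `M = ℚ_p/ℤ_p` itself of `separatesPoints_of_injective` (`j = id`), in the shape of `hsep`.
[cite: NeukirchSchmidtWingberg2008, I §1 (1.1.8)] -/
theorem separatesPoints :
    ∀ (G : Type) [Group G] [Finite G] [IsMulCommutative G], IsPGroup p G →
      ∀ g : G, g ≠ 1 → ∃ χ : G →* Multiplicative (QpModZp p), χ g ≠ 1 :=
  fun G _ _ _ hG _ hg ↦ exists_monoidHom_apply_ne_one p G hG hg

end Literature.NumberTheory.IwasawaTheory.QpModZp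

end
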